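import Summits.Ventures.PercRepro.RankLevelSet
import Summits.Ventures.PercRepro.RankLevelSetCrossStep

/-!
# PercRepro — C-025 REDUCED TO THE CONTRACTION MONOTONICITY OF THE SLACK (night-1, gen 7)

For a finite matroid `M` and `q + 2 ≤ p` let the SLACK of C-025 be
`σ_M(p, q) := #Y_M(p, q) − Φ(p, q)·#U_M(p, q)` (`midCount` minus `phiK` times `topCount`; C-025 at `(p, q)`
says `σ_M(p, q) ≥ 0`).  The inductive object of this file is

  **(MC∃)** — `ContractMonoExists`: for every finite matroid with a non-loop and every `q + 2 ≤ p` there is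
  a non-loop `e` with `σ_{M ／ {e}}(p − 1, q) ≤ σ_M(p, q)`

(night-1 g7, census: (MC) at EVERY non-loop element on all 385,370 matroids with ≤ 9 elements, 0 violations in
12.5 M instances; at every element it is false on truncated sums with a 6-point line; «some e» 0 / 70,291 cells;
mining/night-1/g7/).  The theorem:

* **`c025_of_contractMonoExists`** — `(MC∃) → C025`, by strong induction on `|E|`: pick the element `e` that
  (MC∃) gives, then `σ_M(p, q) ≥ σ_{M/e}(p − 1, q) ≥ 0` — the right side by the induction hypothesis when
  `q + 2 ≤ p − 1`, and directly when `p = q + 2` (`Φ(q + 1, q) = 0`, so `σ(q + 1, q) = #Y ≥ 0`); a matroid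
  without a non-loop has `#U(p, q) = 0` for `p ≥ 1` (every subset has rank `0`).

No truncation, no parallel / coloop / loop lemma enters: (MC∃) at one element per matroid is the whole step.
At `p = q + 2` the statement (MC) at `e` is exactly the diagonal cell `W_{q+1}(M) ≥ Φ(q+2, q)·#U(q+2, q)` of
C-025 (for `#Y_M(q+2, q) = #Y_{M∖e}(q+2, q) + W_q(M/e)`), so (MC∃) is STRONGER than C-025; above the diagonal
it is a new, local statement.  Axioms: standard.
-/

open scoped Matroid

namespace PercRepro

namespace Matroid

open Set

variable {α : Type}

/-- The slack of C-025 for one matroid and one pair: `σ_M(p, q) = #Y_M(p, q) − Φ(p, q)·#U_M(p, q)`. -/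
noncomputable def slack (M : _root_.Matroid α) (p q : ℕ) : ℚ :=
  (midCount M p q : ℚ) - phiK p q * (topCount M p q : ℚ)

/-- C-025 at `(p, q)` is `0 ≤ σ_M(p, q)`. -/
theorem body_iff_slack_nonneg (M : _root_.Matroid α) (p q : ℕ) :
    (phiK p q * ({A : Set α | A ⊆ M.E ∧ M.eRk A = (p : ℕ∞) ∧ M.eRk (M.E \ A) = (q : ℕ∞)}.ncard : ℚ) ≤
        ({A : Set α | A ⊆ M.E ∧ (q : ℕ∞) < M.eRk A ∧ M.eRk A < (p : ℕ∞)}.ncard : ℚ)) ↔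
      0 ≤ slack M p q := by
  unfold slack topCount midCount
  constructor <;> intro h <;> linarith

/-- `Φ(q + 1, q) = 0`: the sum over `q < u < q + 1` is empty. -/
theorem phiK_succ_self (q : ℕ) : phiK (q + 1) q = 0 := by
  unfold phiK
  rw [Finset.sum_eq_zero, zero_div]
  intro u hu
  rw [Finset.mem_Ioo] at hu
  omega

/-- At the trivial pair `(q + 1, q)` the slack is the (nonnegative) middle count. -/
theorem slack_succ_self_nonneg (M : _root_.Matroid α) (q : ℕ) : 0 ≤ slack M (q + 1) q := by
  unfold slack
  rw [phiK_succ_self, zero_mul, sub_zero]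
  exact Nat.cast_nonneg _

/-- A matroid without a non-loop has no set of positive rank, so `#U(p, q) = 0` for `p ≥ 1`. -/
theorem topCount_eq_zero_of_forall_isLoop (M : _root_.Matroid α) (h : ∀ e ∈ M.E, M.IsLoop e)
    {p : ℕ} (hp : 1 ≤ p) (q : ℕ) : topCount M p q = 0 := by
  unfold topCount
  have hempty : {A : Set α | A ⊆ M.E ∧ M.eRk A = (p : ℕ∞) ∧ M.eRk (M.E \ A) = (q : ℕ∞)} = ∅ := by
    rw [Set.eq_empty_iff_forall_notMem]
    rintro A ⟨hAE, hA, -⟩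
    have h0 : M.eRk A = 0 := by
      rw [Matroid.eRk_eq_zero_iff hAE]
      intro x hx
      exact (h x (hAE hx))
    rw [h0] at hA
    have h1 : (p : ℕ∞) = 0 := hA.symm
    have h2 : p = 0 := by exact_mod_cast h1
    omega
  rw [hempty, Set.ncard_empty]

/-- **(MC∃) — CONTRACTION MONOTONICITY OF THE SLACK, existential form**: every finite matroid with a non-loop
has, for every `q + 2 ≤ p`, a non-loop `e` with `σ_{M ／ {e}}(p − 1, q) ≤ σ_M(p, q)`. -/
def ContractMonoExists : Prop :=
  ∀ {α : Type} (M : _root_.Matroid α) [M.Finite] (p q : ℕ), q + 2 ≤ p →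
    (∃ e, M.IsNonloop e) → ∃ e, M.IsNonloop e ∧ slack (M ／ {e}) (p - 1) q ≤ slack M p q

/-- **(MC) — CONTRACTION MONOTONICITY OF THE SLACK at every non-loop** (the census form; FALSE in general —
a point of a 6-point line next to big free pieces fails it — recorded for the twins, not used below). -/
def ContractMono : Prop :=
  ∀ {α : Type} (M : _root_.Matroid α) [M.Finite] (p q : ℕ), q + 2 ≤ p →
    ∀ e, M.IsNonloop e → slack (M ／ {e}) (p - 1) q ≤ slack M p q

/-- (MC) implies (MC∃). -/
theorem contractMonoExists_of_contractMono (h : ContractMono) : ContractMonoExists := by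
  intro α M _ p q hpq ⟨e, he⟩
  exact ⟨e, he, h M p q hpq e he⟩

/-- The induction: under (MC∃), `σ_M(p, q) ≥ 0` for every finite matroid (strong induction on `|E|`). -/
theorem slack_nonneg_of_contractMonoExists (h : ContractMonoExists) :
    ∀ (n : ℕ) {α : Type} (M : _root_.Matroid α) [M.Finite], M.E.ncard = n →
      ∀ (p q : ℕ), q + 2 ≤ p → 0 ≤ slack M p q := by
  intro n
  induction n using Nat.strong_induction_on with
  | _ n ih =>
    intro α M hMfin hn p q hpq
    by_cases hnl : ∃ e, M.IsNonloop e
    · obtain ⟨e, he, hMC⟩ := h M p q hpq hnl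
      refine le_trans ?_ hMC
      by_cases hp : q + 2 ≤ p - 1
      · have heE : e ∈ M.E := he.mem_ground
        have hlt : (M ／ {e}).E.ncard < n := by
          rw [Matroid.contract_ground, ← hn]
          exact Set.ncard_sdiff_singleton_lt_of_mem heE M.ground_finite
        exact ih _ hlt (M ／ {e}) rfl (p - 1) q hp
      · have hp' : p - 1 = q + 1 := by omega
        rw [hp']
        exact slack_succ_self_nonneg _ q
    · have hloop : ∀ e ∈ M.E, M.IsLoop e := by
        intro e heE
        rcases M.isLoop_or_isNonloop e heE with hl | hnl'
        · exact hl
        · exact absurd ⟨e, hnl'⟩ hnl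
      unfold slack
      rw [topCount_eq_zero_of_forall_isLoop M hloop (by omega) q]
      simp

/-- **C-025 FROM (MC∃)**: the contraction monotonicity of the slack at one element per matroid implies the
rank level-set inequality for every finite matroid and every `q + 2 ≤ p`. -/
theorem c025_of_contractMonoExists (h : ContractMonoExists) : C025 := by
  intro α M _ p q hpq
  rw [body_iff_slack_nonneg]
  exact slack_nonneg_of_contractMonoExists h _ M rfl p q hpq

/-- **C-025 FROM (MC)** (the every-element form). -/
theorem c025_of_contractMono (h : ContractMono) : C025 :=
  c025_of_contractMonoExists (contractMonoExists_of_contractMono h)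

end Matroid

end PercRepro
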